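import Summits.BirchSwinnertonDyer.Rank1Residual.GaloisImage.CongruenceVisibilityTwistedCocycle
import Summits.BirchSwinnertonDyer.Rank1Residual.GaloisImage.CongruenceVisibilityIdentityComponent
import HarnessLib

/-!
# THEOREM B in the comparison-index currency: `ι_{v₀}(θ) ≤ 3` on σ = E0/E0 at additive `3`
# (cell `b2b-bsdres`, team n1011, seat p10 GEN 9; ROW T-VIS3-UC-IOTA FILE 1b;
# skeleton `cells/n1011/skel/T-VIS3-UC-IOTA.md`)

HONEST FRAMING (cell `b2b-bsdres`, run/shared/lean/b2b/bsd-rank1-residual/, verbatim in every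
file): the goal of the cell is to DELETE the COMBINATION-SHAPED residual classes of the
Birch–Swinnerton-Dyer formula for ALL analytic-rank `≤ 1` elliptic curves over `ℚ` — "full BSD
formula for every rank `≤ 1` curve in class `C`" assembled STRICTLY from published theorems — so
that the rank-`≤ 1` remainder becomes exactly the CONSTRUCTION-SHAPED classes, which are TYPED
(missing-input `Prop`s), NOT attempted. This is not "finishing BSD". Team n1011 (N10 / N11):
research route on the CONSTRUCTION-SHAPED class X4 (§I N11 LOWER half / O7); no claim beyond the
stated classes; nothing is booked; marks UNCHANGED. Theorems only: no definition, no named fact,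
no `sorry`. TOOL theorems; they close nothing by themselves.

## What

THEOREM B (FILE 8b `CongruenceVisibilityIdentityComponent`, L41-NOTE §2: "an E0/E0 `3`-congruence
at additive `3` costs at most ONE local dimension") restated as a bound on the tree's COMPARISON
INDEX `ι_v(θ) = [θ_* 𝓢_v(E') : θ_* 𝓢_v(E') ∩ 𝓢_v(E)]`
(`Literature/NumberTheory/EllipticCurves/CongruenceVisibilityComparison.lean`; 8b's `hoff` is
`ι_v(θ) = 1`):
* `relIndex_map_selmerLocalKer_le_three_of_twists` — the ABSTRACT form: from the two local twist
  data (for each curve a point of `E(K̄_{v₀})` fixed by `Stab(α)`, moved by `F₀`, with `3 •` it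
  rational) and `#E(K_{v₀})[3] = #E'(K_{v₀})[3] = 3`: **`ι_{v₀}(θ) ≤ 3`.** Proof: `R' := 3 • Q₀'`
  lies in `E'(K_{v₀}) ∖ 3E'(K_{v₀})` (an `H`-fixed `3`-torsion point is `Γ`-fixed, FILE 3 of
  T-VIS3-UC), `N = 3E'(K_{v₀}) + ℤR'` has index `≤ 3` (`#E'(K_{v₀})/3 = 9`); four classes of
  `𝓢_{v₀}(E')` have underlying `K_{v₀}`-points `x_i` (`3 • a'_i = x_i`), two agree modulo `N`, the
  class-level criterion (d) (FILE 1a) applies to the difference with `Q' = s + k • Q₀'`, and the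
  collision lemma (FILE 1a) concludes;
* `relIndex_map_selmerLocalKer_le_three_of_identityComponent` — with EXACTLY 8b's `v₀`-binders
  (cuspidal integral models + identity-component `3`-torsion points, T-SIG3-TRI's output), the two
  twist data being THEOREM A (FILE 8a `exists_localPoints_twist_of_identityComponent`).
FILE 2 (`…IndexEnds`) feeds this into the master count `exists_sha_ne_zero_of_congr_of_relIndex_lt`.
References: [CremonaMazur2000] §3; [AgasheStein2002] §3.5; [MazurRubin2004] §2.3;
[MilneADT2006] I.3.3, I.3.8; L41-NOTE §§1–2 (`HOME/b2b-bsdres-n1011-p10/g8/`). -/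

noncomputable section

open scoped Classical

namespace Summit.BirchSwinnertonDyer.Rank1Residual.GaloisImage.TwistedWitness

open WeierstrassCurve Literature.NumberTheory.EllipticCurves Literature.NumberTheory.GaloisRepresentations
open Field NumberField IsDedekindDomain IsDedekindDomain.HeightOneSpectrum

section Main

/-- **`ι_{v₀}(θ) ≤ 3` from the two local TWIST data** (the abstract form of THEOREM B in the
comparison-index currency). `v₀` with `#(𝓞_{v₀}/3) = 3` and the three `ℚ₃`-facts (so that
`H = Stab(α)`, `α³ = α + 1`, is normal of index `3` in `Γ_{K_{v₀}}` and `H`-fixed `3`-torsion is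
`Γ`-fixed), `#E(K_{v₀})[3] = #E'(K_{v₀})[3] = 3`, `F₀ • α ≠ α`, and for EACH curve a point of
`E(K̄_{v₀})` fixed by `Stab(α)`, moved by `F₀`, with `3 •` it `Γ`-fixed (THEOREM A's output: FILE 8a
at a cuspidal model with an identity-component `3`-torsion point; at GOOD reduction Milne I.3.8).
Then `[θ_* 𝓢_{v₀}(E') : θ_* 𝓢_{v₀}(E') ∩ 𝓢_{v₀}(E)] ≤ 3`. Proof in the module docstring.
[cite: CremonaMazur2000, §3 pp. 19–22] [cite: MilneADT2006, Ch. I Prop. 3.8 and Lemma 3.3] -/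
theorem relIndex_map_selmerLocalKer_le_three_of_twists {K : Type} [Field K] [NumberField K]
    (W W' : WeierstrassCurve K) [W.IsElliptic] [W'.IsElliptic]
    (θ : geomTorsion W' ((3 : ℕ) : ℤ) ≃+ geomTorsion W ((3 : ℕ) : ℤ))
    (hθ : ∀ (σ : absoluteGaloisGroup K) (P : geomTorsion W' ((3 : ℕ) : ℤ)), θ (σ • P) = σ • θ P)
    (v₀ : HeightOneSpectrum (𝓞 K))
    (hO3 : Nat.card (v₀.adicCompletionIntegers K ⧸
      Ideal.span {((3 : ℕ) : v₀.adicCompletionIntegers K)}) = 3)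
    {δ : v₀.adicCompletion K} (hδ : δ ^ 2 = -23)
    (hnoroot : ∀ x : v₀.adicCompletion K, x ^ 3 - x - 1 ≠ 0)
    (hn3 : ∀ y : v₀.adicCompletion K, y ^ 2 ≠ -3)
    (hcard : Nat.card (nsmulAddMonoidHom 3 :
      (W.baseChange (v₀.adicCompletion K)).toAffine.Point →+ _).ker = 3)
    (hcard' : Nat.card (nsmulAddMonoidHom 3 :
      (W'.baseChange (v₀.adicCompletion K)).toAffine.Point →+ _).ker = 3)
    {α : AlgebraicClosure (v₀.adicCompletion K)} (hα : α ^ 3 = α + 1)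
    (F₀ : absoluteGaloisGroup (v₀.adicCompletion K)) (hF₀ : F₀ • α ≠ α)
    (Q₁ : localPoints W (v₀.adicCompletion K))
    (hQ₁H : ∀ h : absoluteGaloisGroup (v₀.adicCompletion K), h • α = α → h • Q₁ = Q₁)
    (hQ₁F : F₀ • Q₁ ≠ Q₁)
    (hQ₁3 : ∀ σ : absoluteGaloisGroup (v₀.adicCompletion K), σ • ((3 : ℤ) • Q₁) = (3 : ℤ) • Q₁)
    (Q₀' : localPoints W' (v₀.adicCompletion K))
    (hQ₀'H : ∀ h : absoluteGaloisGroup (v₀.adicCompletion K), h • α = α → h • Q₀' = Q₀')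
    (hQ₀'F : F₀ • Q₀' ≠ Q₀')
    (hQ₀'3 : ∀ σ : absoluteGaloisGroup (v₀.adicCompletion K), σ • ((3 : ℤ) • Q₀') = (3 : ℤ) • Q₀') :
    (selmerLocalKer W (v₀.adicCompletion K) ((3 : ℕ) : ℤ)).relIndex
      ((selmerLocalKer W' (v₀.adicCompletion K) ((3 : ℕ) : ℤ)).map
        (h1Equiv θ hθ).toAddMonoidHom) ≤ 3 := by
  haveI : Fact (Nat.Prime 3) := ⟨Nat.prime_three⟩
  haveI : CharZero (v₀.adicCompletion K) := charZero_adicCompletion v₀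
  have hn : ((3 : ℕ) : ℤ) ≠ 0 := by norm_num
  have e33 : ((3 : ℕ) : ℤ) = 3 := by norm_num
  set H := MulAction.stabilizer (absoluteGaloisGroup (v₀.adicCompletion K)) α with hHdef
  haveI hHn : H.Normal := normal_stabilizer_cubicRoot hα hδ
  have hHi : H.index = 3 := index_stabilizer_cubicRoot hα hδ hnoroot
  have hmemH : ∀ σ : absoluteGaloisGroup _, σ ∈ H ↔ σ • α = α := fun σ ↦ MulAction.mem_stabilizer_iff
  have hF₀H : F₀ ∉ H := fun h ↦ hF₀ ((hmemH F₀).mp h)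
  have hgen := exists_pow_mul_of_index_eq_prime H hHi hF₀H
  have hF3 : F₀ ^ 3 ∈ H := by rw [← hHi]; exact Subgroup.pow_index_mem H F₀
  have hζ := exists_mem_stabilizer_smul_ne_of_cube_eq_one hα hδ hnoroot hn3
  have hfixW := smul_eq_of_torsion_of_fixed_of_rootsOfUnity W _ (p := 3) H hHn F₀ hgen hF3 hζ
  have hfixW' := smul_eq_of_torsion_of_fixed_of_rootsOfUnity W' _ (p := 3) H hHn F₀ hgen hF3 hζ
  have hcyc := exists_eq_zsmul_of_natCard_ker_nsmul_eq W (v₀.adicCompletion K) (p := 3) hcard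
  have hQ₁fix : ((3 : ℕ) : ℤ) • Q₁ ∈ MulAction.fixedPoints (absoluteGaloisGroup (v₀.adicCompletion K))
      (localPoints W (v₀.adicCompletion K)) := by rw [e33]; exact fun σ ↦ hQ₁3 σ
  set ψ : (W'.baseChange (v₀.adicCompletion K)).toAffine.Point →+ localPoints W' (v₀.adicCompletion K) :=
    (W'.baseChangeGeomPointsEquiv (v₀.adicCompletion K)).toAddMonoidHom.comp
      (toGeomPoints (W'.baseChange (v₀.adicCompletion K))) with hψdef
  have hψ : ∀ R, ψ R = W'.baseChangeGeomPointsEquiv (v₀.adicCompletion K)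
      (toGeomPoints (W'.baseChange (v₀.adicCompletion K)) R) := fun R ↦ rfl
  have hψfix : ∀ R (σ : absoluteGaloisGroup (v₀.adicCompletion K)), σ • ψ R = ψ R := fun R σ ↦
    VisibleWitness.baseChangeGeomPointsEquiv_toGeomPoints_mem_fixedPoints W' (v₀.adicCompletion K) R σ
  have hψsurj : ∀ T : localPoints W' (v₀.adicCompletion K),
      (∀ σ : absoluteGaloisGroup (v₀.adicCompletion K), σ • T = T) → ∃ R, ψ R = T := by
    intro T hT
    have hfix : (W'.baseChangeGeomPointsEquiv (v₀.adicCompletion K)).symm T ∈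
        MulAction.fixedPoints (absoluteGaloisGroup (v₀.adicCompletion K))
          (geomPoints (W'.baseChange (v₀.adicCompletion K))) := fun σ ↦ by
      rw [← baseChangeGeomPointsEquiv_symm_smul, hT σ]
    obtain ⟨R, hR⟩ := (mem_range_toGeomPoints_iff (W'.baseChange (v₀.adicCompletion K)) _).mpr hfix
    exact ⟨R, by rw [hψ, hR, AddEquiv.apply_symm_apply]⟩
  obtain ⟨R', hR'⟩ := hψsurj ((3 : ℤ) • Q₀') hQ₀'3
  -- `R' ∉ 3 E'(K_v)` (a `Stab(α)`-fixed `3`-torsion point is `Γ`-fixed, but `F₀` moves `Q₀'`)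
  have hR'not : R' ∉ (nsmulAddMonoidHom 3 :
      (W'.baseChange (v₀.adicCompletion K)).toAffine.Point →+ _).range := by
    rintro ⟨S₀, hS₀⟩
    rw [nsmulAddMonoidHom_apply] at hS₀
    have hψS₀ : ((3 : ℕ) : ℤ) • ψ S₀ = (3 : ℤ) • Q₀' := by
      rw [natCast_zsmul, ← map_nsmul, hS₀, hR']
    have hD3 : ((3 : ℕ) : ℤ) • (Q₀' - ψ S₀) = 0 := by
      rw [zsmul_sub, hψS₀, sub_eq_zero]
      norm_num
    have hDH : ∀ h ∈ H, h • (Q₀' - ψ S₀) = Q₀' - ψ S₀ := fun h hh ↦ by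
      rw [smul_sub, hQ₀'H h ((hmemH h).mp hh), hψfix]
    have hDF := hfixW' (Q₀' - ψ S₀) hD3 hDH F₀
    rw [smul_sub, hψfix, sub_left_inj] at hDF
    exact hQ₀'F hDF
  set R3 : AddSubgroup (W'.baseChange (v₀.adicCompletion K)).toAffine.Point :=
    (nsmulAddMonoidHom 3 : (W'.baseChange (v₀.adicCompletion K)).toAffine.Point →+ _).range with hR3
  have hR3idx : R3.index = 9 := by
    rw [hR3, AddSubgroup.index, W'.card_quotient_range_nsmul_adicCompletion v₀ (by norm_num : (3 : ℕ) ≠ 0),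
      hcard', hO3]
  set N : AddSubgroup (W'.baseChange (v₀.adicCompletion K)).toAffine.Point :=
    R3 ⊔ AddSubgroup.zmultiples R' with hN
  have hle : R3 ≤ N := le_sup_left
  have hmul := AddSubgroup.relIndex_mul_index hle
  rw [hR3idx] at hmul
  have hne1 : R3.relIndex N ≠ 1 := by
    rw [Ne, AddSubgroup.relIndex_eq_one]
    intro hNle
    exact hR'not (hNle (AddSubgroup.mem_sup_right (AddSubgroup.mem_zmultiples R')))
  have hNidx : N.index ≤ 3 ∧ N.index ≠ 0 := by
    have h9 : N.index ∣ 9 := Dvd.intro_left _ hmul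
    have hle9 : N.index ≤ 9 := Nat.le_of_dvd (by norm_num) h9
    interval_cases hidx : N.index <;> omega
  haveI : N.FiniteIndex := ⟨hNidx.2⟩
  haveI : Finite ((W'.baseChange (v₀.adicCompletion K)).toAffine.Point ⧸ N) :=
    AddSubgroup.finite_quotient_of_finiteIndex
  letI : Fintype ((W'.baseChange (v₀.adicCompletion K)).toAffine.Point ⧸ N) := Fintype.ofFinite _
  -- §1: among any four classes of `θ_* 𝓢_{v₀}(E')` two differ by a class of `𝓢_{v₀}(E)`
  refine relIndex_le_of_forall_exists_sub_mem _ _ 3 (fun f hf ↦ ?_)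
  choose c hc hfc using fun i ↦ AddSubgroup.mem_map.mp (hf i)
  choose φ hφ using fun i ↦
    oneCocycleClass_surjective (discreteTopRep (absoluteGaloisGroup K) (geomTorsion W' ((3 : ℕ) : ℤ))) (c i)
  have hc' : ∀ i, ∃ b : localPoints W' (v₀.adicCompletion K),
      ∀ σ : absoluteGaloisGroup (v₀.adicCompletion K),
        pointsMap W' (v₀.adicCompletion K)
          (((φ i).1 (resGal (K := K) (v₀.adicCompletion K) σ) : geomTorsion W' ((3 : ℕ) : ℤ)) :
            geomPoints W') = σ • b - b := by
    intro i
    have h := hc i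
    rw [← hφ i, selmerLocalKer, oneCocycleClass_mem_resKer_iff] at h
    obtain ⟨b, hb⟩ := h
    exact ⟨b, fun σ ↦ hb σ⟩
  choose b hb using hc'
  have hbfix : ∀ i (σ : absoluteGaloisGroup (v₀.adicCompletion K)),
      σ • (((3 : ℕ) : ℤ) • b i) = ((3 : ℕ) : ℤ) • b i := by
    intro i σ
    have h0 : ((3 : ℕ) : ℤ) • (σ • b i - b i) = 0 := by
      rw [← hb i σ, ← map_zsmul, (mem_geomTorsion_iff W' _ _).mp ((φ i).1 _).2, map_zero]
    rw [W'.smul_zsmul_localPoints ((3 : ℕ) : ℤ) σ (b i)]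
    rw [zsmul_sub, sub_eq_zero] at h0
    exact h0
  choose x hx using fun i ↦ hψsurj _ (hbfix i)
  have hlt : Fintype.card ((W'.baseChange (v₀.adicCompletion K)).toAffine.Point ⧸ N) <
      Fintype.card (Fin (3 + 1)) := by
    rw [Fintype.card_fin, ← Nat.card_eq_fintype_card, ← AddSubgroup.index_eq_card]
    omega
  obtain ⟨i, j, hij, hq⟩ := Fintype.exists_ne_map_eq_of_card_lt
    (fun i ↦ (QuotientAddGroup.mk (x i) : (W'.baseChange (v₀.adicCompletion K)).toAffine.Point ⧸ N)) hlt
  have hxN : x i - x j ∈ N := (QuotientAddGroup.eq_iff_sub_mem).mp hq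
  refine ⟨i, j, hij, ?_⟩
  -- decompose `x i - x j = 3 s + k R'` and form the `H`-fixed `Q' = ψ s + k • Q₀'`
  obtain ⟨y₃, hy₃, z, hz, hsum⟩ := AddSubgroup.mem_sup.mp hxN
  obtain ⟨s, rfl⟩ := hy₃
  obtain ⟨k, rfl⟩ := AddSubgroup.mem_zmultiples_iff.mp hz
  rw [nsmulAddMonoidHom_apply] at hsum
  set Q' : localPoints W' (v₀.adicCompletion K) := ψ s + k • Q₀' with hQ'def
  have hQ'H : ∀ h ∈ H, h • Q' = Q' := fun h hh ↦ by
    rw [hQ'def, smul_add, hψfix, W'.smul_zsmul_localPoints, hQ₀'H h ((hmemH h).mp hh)]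
  have hQ' : ((3 : ℕ) : ℤ) • Q' = ((3 : ℕ) : ℤ) • (b i - b j) := by
    calc ((3 : ℕ) : ℤ) • Q' = ((3 : ℕ) : ℤ) • ψ s + k • ((3 : ℤ) • Q₀') := by
          rw [hQ'def, smul_add, smul_comm ((3 : ℕ) : ℤ) k Q₀', e33]
      _ = ψ (3 • s + k • R') := by rw [map_add, map_nsmul, map_zsmul, hR', natCast_zsmul]
      _ = ((3 : ℕ) : ℤ) • (b i - b j) := by rw [hsum, map_sub, hx i, hx j, smul_sub]
  rw [← hfc i, ← hfc j, ← map_sub]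
  change h1Equiv θ hθ (c i - c j) ∈ selmerLocalKer W (v₀.adicCompletion K) ((3 : ℕ) : ℤ)
  rw [← hφ i, ← hφ j, ← oneCocycleClass_sub]
  refine h1Equiv_oneCocycleClass_mem_selmerLocalKer_of_twistedCocycle W W' θ hθ (v₀.adicCompletion K) hn
    (φ i - φ j) (b i - b j) (fun σ ↦ ?_) H hHn F₀ hgen hfixW hfixW' hcyc Q' hQ'H hQ' Q₁
    (fun h hh ↦ hQ₁H h ((hmemH h).mp hh)) hQ₁fix hQ₁F
  have e : (((φ i - φ j).1 (resGal (K := K) (v₀.adicCompletion K) σ) : geomTorsion W' ((3 : ℕ) : ℤ)) :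
      geomPoints W') =
      (((φ i).1 (resGal (K := K) (v₀.adicCompletion K) σ) : geomTorsion W' ((3 : ℕ) : ℤ)) : geomPoints W') -
        (((φ j).1 (resGal (K := K) (v₀.adicCompletion K) σ) : geomTorsion W' ((3 : ℕ) : ℤ)) : geomPoints W') := by
    rw [← AddSubgroup.coe_sub]
    rfl
  rw [e, map_sub, hb i σ, hb j σ, smul_sub]
  abel

/-- **THEOREM B in the comparison-index currency: `ι_{v₀}(θ) ≤ 3` (σ = E0/E0, certificate-free at
`3`).** Binders = those of 8b at `v₀` (`v₀ ∣ 3`, `#(𝓞_{v₀}/3) = 3`, the three `ℚ₃`-facts,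
`#E(K_{v₀})[3] = #E'(K_{v₀})[3] = 3`, per curve an integral model with CUSPIDAL reduction and a
`3`-torsion point of NONSINGULAR reduction on it — T-SIG3-TRI's output). Conclusion:
`[θ_* 𝓢_{v₀}(E') : θ_* 𝓢_{v₀}(E') ∩ 𝓢_{v₀}(E)] ≤ 3` — at most ONE of the two local dimensions is
paid. Proof in the module docstring.
[cite: CremonaMazur2000, §3 pp. 19–22] [cite: MilneADT2006, Ch. I Prop. 3.8 and Lemma 3.3] -/
theorem relIndex_map_selmerLocalKer_le_three_of_identityComponent {K : Type} [Field K] [NumberField K]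
    (W W' : WeierstrassCurve K) [W.IsElliptic] [W'.IsElliptic]
    (θ : geomTorsion W' ((3 : ℕ) : ℤ) ≃+ geomTorsion W ((3 : ℕ) : ℤ))
    (hθ : ∀ (σ : absoluteGaloisGroup K) (P : geomTorsion W' ((3 : ℕ) : ℤ)), θ (σ • P) = σ • θ P)
    (v₀ : HeightOneSpectrum (𝓞 K)) (h3v : ((3 : ℕ) : 𝓞 K) ∈ v₀.asIdeal)
    (hO3 : Nat.card (v₀.adicCompletionIntegers K ⧸
      Ideal.span {((3 : ℕ) : v₀.adicCompletionIntegers K)}) = 3)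
    {δ : v₀.adicCompletion K} (hδ : δ ^ 2 = -23)
    (hnoroot : ∀ x : v₀.adicCompletion K, x ^ 3 - x - 1 ≠ 0)
    (hn3 : ∀ y : v₀.adicCompletion K, y ^ 2 ≠ -3)
    (hcard : Nat.card (nsmulAddMonoidHom 3 :
      (W.baseChange (v₀.adicCompletion K)).toAffine.Point →+ _).ker = 3)
    (hcard' : Nat.card (nsmulAddMonoidHom 3 :
      (W'.baseChange (v₀.adicCompletion K)).toAffine.Point →+ _).ker = 3)
    (M : WeierstrassCurve (v₀.adicCompletionIntegers K)) (C : VariableChange (v₀.adicCompletion K))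
    (hC : C • W.baseChange (v₀.adicCompletion K) =
      M.map (algebraMap (v₀.adicCompletionIntegers K) (v₀.adicCompletion K)))
    (x₀ y₀ a : IsLocalRing.ResidueField (v₀.adicCompletionIntegers K))
    (hcusp : M.map (IsLocalRing.residue (v₀.adicCompletionIntegers K)) = singularModel x₀ y₀ a a)
    {a₀ b₀ : v₀.adicCompletionIntegers K}
    (hns₀ : (M.map (IsLocalRing.residue (v₀.adicCompletionIntegers K))).toAffine.Nonsingular
      (IsLocalRing.residue (v₀.adicCompletionIntegers K) a₀)
      (IsLocalRing.residue (v₀.adicCompletionIntegers K) b₀))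
    (hm : ((M.map (algebraMap (v₀.adicCompletionIntegers K) (v₀.adicCompletion K))).baseChange
        (AlgebraicClosure (v₀.adicCompletion K))).toAffine.Nonsingular
      (algebraMap (v₀.adicCompletionIntegers K) (AlgebraicClosure (v₀.adicCompletion K)) a₀)
      (algebraMap (v₀.adicCompletionIntegers K) (AlgebraicClosure (v₀.adicCompletion K)) b₀))
    (h3 : (3 : ℤ) • (Affine.Point.some _ _ hm :
      ((M.map (algebraMap (v₀.adicCompletionIntegers K) (v₀.adicCompletion K))).baseChange
        (AlgebraicClosure (v₀.adicCompletion K))).toAffine.Point) = 0)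
    (M' : WeierstrassCurve (v₀.adicCompletionIntegers K)) (C' : VariableChange (v₀.adicCompletion K))
    (hC' : C' • W'.baseChange (v₀.adicCompletion K) =
      M'.map (algebraMap (v₀.adicCompletionIntegers K) (v₀.adicCompletion K)))
    (x₀' y₀' a' : IsLocalRing.ResidueField (v₀.adicCompletionIntegers K))
    (hcusp' : M'.map (IsLocalRing.residue (v₀.adicCompletionIntegers K)) = singularModel x₀' y₀' a' a')
    {a₀' b₀' : v₀.adicCompletionIntegers K}
    (hns₀' : (M'.map (IsLocalRing.residue (v₀.adicCompletionIntegers K))).toAffine.Nonsingular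
      (IsLocalRing.residue (v₀.adicCompletionIntegers K) a₀')
      (IsLocalRing.residue (v₀.adicCompletionIntegers K) b₀'))
    (hm' : ((M'.map (algebraMap (v₀.adicCompletionIntegers K) (v₀.adicCompletion K))).baseChange
        (AlgebraicClosure (v₀.adicCompletion K))).toAffine.Nonsingular
      (algebraMap (v₀.adicCompletionIntegers K) (AlgebraicClosure (v₀.adicCompletion K)) a₀')
      (algebraMap (v₀.adicCompletionIntegers K) (AlgebraicClosure (v₀.adicCompletion K)) b₀'))
    (h3' : (3 : ℤ) • (Affine.Point.some _ _ hm' :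
      ((M'.map (algebraMap (v₀.adicCompletionIntegers K) (v₀.adicCompletion K))).baseChange
        (AlgebraicClosure (v₀.adicCompletion K))).toAffine.Point) = 0) :
    (selmerLocalKer W (v₀.adicCompletion K) ((3 : ℕ) : ℤ)).relIndex
      ((selmerLocalKer W' (v₀.adicCompletion K) ((3 : ℕ) : ℤ)).map
        (h1Equiv θ hθ).toAddMonoidHom) ≤ 3 := by
  haveI : CharZero (v₀.adicCompletion K) := charZero_adicCompletion v₀
  obtain ⟨α, hα⟩ := exists_cubicRoot (v₀.adicCompletion K)
  obtain ⟨F₀, hF₀H⟩ := exists_smul_cubicRoot_ne hα hδ hnoroot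
  have hF₀ : F₀ • α ≠ α := fun h ↦ hF₀H (MulAction.mem_stabilizer_iff.mpr h)
  obtain ⟨Q₁, T₁, hT₁0, -, -, hQ₁H, hQ₁F, hQ₁3⟩ :=
    exists_localPoints_twist_of_identityComponent W h3v M C hC x₀ y₀ a hcusp hα hδ hnoroot F₀ hF₀ hns₀ hm h3
  obtain ⟨Q₀', T', hT'0, -, -, hQ₀'H, hQ₀'F, hQ₀'3⟩ :=
    exists_localPoints_twist_of_identityComponent W' h3v M' C' hC' x₀' y₀' a' hcusp' hα hδ hnoroot F₀ hF₀
      hns₀' hm' h3'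
  exact relIndex_map_selmerLocalKer_le_three_of_twists W W' θ hθ v₀ hO3 hδ hnoroot hn3 hcard hcard' hα F₀
    hF₀ Q₁ hQ₁H (fun h ↦ hT₁0 (by rw [← hQ₁F, h, sub_self])) hQ₁3 Q₀' hQ₀'H
    (fun h ↦ hT'0 (by rw [← hQ₀'F, h, sub_self])) hQ₀'3

end Main

end Summit.BirchSwinnertonDyer.Rank1Residual.GaloisImage.TwistedWitness

end
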